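import Literature.IUT.HodgeTheaters.KappaCoricGalois
import Literature.IUT.HodgeTheaters.ThetaHodgeTheatersRemarksA
import Literature.IUT.HodgeTheaters.ThetaHodgeTheatersRemarksA2
import Mathlib.LinearAlgebra.Complex.Module
import Mathlib.FieldTheory.Galois.Basic
import HarnessLib

/-!
# Kernel closure census of four [IUTchI] §3 / §5 vocabulary PREDICATES of the frozen fact list

S. Mochizuki, *Inter-universal Teichmüller theory I*, RIMS manuscript (May 2020), §3 Remarks 3.1.7 (iv),
3.2.2, 3.2.3 (ii) and §5 Example 5.1 (i) [cite: Mochizuki2012, IUTchI Rmk 3.1.7 (iv) p.68]; the group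
theoretic inputs are [NodNon] Rmk 3.1.7 (iv) («`Gal(L̄_C/L_C(κ-sol))` is center-free»), [FrdII]
Ex. 1.1 (ii) (nearly absolutely primitive divisor monoids) and [FrdI] Rmk 3.2.3 (ii) (injectivity of
the pull-back of birational units along linear morphisms).

PROOF-ONLY file (no new definitions).  The abc-iut cell typed these four printed claims as
`Prop`-valued PREDICATES WITH FREE PARAMETERS (a bare group, an intermediate field, abstract fibre
monoids, abstract birational-units data) — hypothesis shapes, not published theorems — and the frozen
fact list carries them as fact rows: plan/FACT-LIST.md F-1391 `KappaSolGalois.CenterFree`, F-1392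
`KappaSol.CenterFree`, F-1314 `NearlyAbsolutelyPrimitive`, F-0751 `InjectiveAlongLinear`
(plan/F-TRANCHES.tsv tranches 191, 194).  This file records, in the kernel, for each of them:

* the UNIVERSAL CLOSURE is FALSE — an explicit counter-instance (an abelian group of order two,
  `Gal(ℂ/ℝ)`, the additive monoid `ℕ`, the trivial pull-back on `ℤ`), so the row is neither a theorem to
  prove nor an assumption to bind unapplied; and
* the predicate is INHABITED — an explicit instance — so consumers taking it as a hypothesis at the
  intended data are not trivially vacuous.

Every proof is a few lines of group theory over Mathlib.  Classical; no bearing on, and no side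
taken on, [IUTchIII] Cor. 3.12; `typed ≠ proved`; a fact-list row is an assumption label, not an
endorsement.
-/

namespace Literature.IUT.HodgeTheaters

/-! ## F-1391 `KappaSolGalois.CenterFree` ([IUTchI] Rmk 3.1.7 (iv), final display) -/

namespace KappaSolGalois

/-- **Row F-1391 is a schema, not a fact**: a bare subgroup need not be center-free — the whole group
`Multiplicative (ZMod 2)` (discrete topology) is abelian and nontrivial, so its center is everything.
[cite: Mochizuki2012, IUTchI Rmk 3.1.7 (iv) p.68] -/
theorem not_forall_centerFree :
    ¬ ∀ (Γ : Type) [Group Γ] [TopologicalSpace Γ] (G : Subgroup Γ), CenterFree G := by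
  intro h
  letI : TopologicalSpace (Multiplicative (ZMod 2)) := ⊥
  have hc : Subgroup.center (⊤ : Subgroup (Multiplicative (ZMod 2))) = ⊥ := h _ ⊤
  have hx : (⟨Multiplicative.ofAdd 1, trivial⟩ : (⊤ : Subgroup (Multiplicative (ZMod 2)))) ∈
      Subgroup.center (⊤ : Subgroup (Multiplicative (ZMod 2))) := by
    rw [Subgroup.center_eq_top]
    trivial
  rw [hc, Subgroup.mem_bot, Subtype.ext_iff] at hx
  exact absurd (congrArg Multiplicative.toAdd hx) (by decide)

/-- … and the predicate is inhabited: the trivial subgroup (of any topological group) is center-free.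
[cite: Mochizuki2012, IUTchI Rmk 3.1.7 (iv) p.68] -/
theorem centerFree_bot (Γ : Type*) [Group Γ] [TopologicalSpace Γ] : CenterFree (⊥ : Subgroup Γ) :=
  Subsingleton.elim _ _

end KappaSolGalois

/-! ## F-1392 `KappaSol.CenterFree` ([IUTchI] Rmk 3.1.7 (iv) / [NodNon] Rmk 3.1.7 (iv)) -/

namespace KappaSol

open Complex in
/-- Any two `ℝ`-algebra automorphisms of `ℂ` commute (each is the identity or complex conjugation,
Mathlib `Complex.real_algHom_eq_id_or_conj`). [folklore] -/
private theorem algEquiv_complex_real_comm (f g : ℂ ≃ₐ[ℝ] ℂ) : f * g = g * f := by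
  have key : ∀ e : ℂ ≃ₐ[ℝ] ℂ, e = AlgEquiv.refl ∨ e = conjAe := fun e => by
    rcases real_algHom_eq_id_or_conj (e : ℂ →ₐ[ℝ] ℂ) with h | h
    · exact Or.inl (AlgEquiv.coe_toAlgHom_injective h)
    · exact Or.inr (AlgEquiv.coe_toAlgHom_injective h)
  rcases key f with rfl | rfl <;> rcases key g with rfl | rfl <;> rfl

/-- **Row F-1392 is a schema, not a fact**: for `K = ℝ ⊆ Ω = ℂ` and `M = ℝ` (the bottom intermediate
field), `Gal(ℂ/ℝ) = Fix(M)` is abelian of order two, hence NOT center-free.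
[cite: Mochizuki2012, IUTchI Rmk 3.1.7 (iv) p.68] -/
theorem not_forall_centerFree :
    ¬ ∀ (K Ω : Type) [Field K] [Field Ω] [Algebra K Ω] (M : IntermediateField K Ω), CenterFree K Ω M := by
  intro h
  have hc := h ℝ ℂ ⊥
  unfold CenterFree at hc
  -- complex conjugation, as an element of `Fix(⊥) = ⊤`
  have hmem : (Complex.conjAe : ℂ ≃ₐ[ℝ] ℂ) ∈ (⊥ : IntermediateField ℝ ℂ).fixingSubgroup := by
    rw [IntermediateField.fixingSubgroup_bot]; trivial
  have hcent : (⟨Complex.conjAe, hmem⟩ : (⊥ : IntermediateField ℝ ℂ).fixingSubgroup) ∈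
      Subgroup.center ((⊥ : IntermediateField ℝ ℂ).fixingSubgroup) := by
    rw [Subgroup.mem_center_iff]
    intro g
    exact Subtype.ext (algEquiv_complex_real_comm _ _)
  rw [hc, Subgroup.mem_bot, Subtype.ext_iff] at hcent
  have h1 := congrArg (fun f : ℂ ≃ₐ[ℝ] ℂ => f Complex.I) hcent
  simp only [Complex.conjAe_coe, Complex.conj_I, Subgroup.coe_one, AlgEquiv.one_apply] at h1
  have h2 := congrArg Complex.im h1
  norm_num at h2

/-- … and the predicate is inhabited: for `M = Ω` (the top intermediate field) `Fix(M)` is trivial,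
hence center-free. [cite: Mochizuki2012, IUTchI Rmk 3.1.7 (iv) p.68] -/
theorem centerFree_top (K Ω : Type*) [Field K] [Field Ω] [Algebra K Ω] :
    CenterFree K Ω (⊤ : IntermediateField K Ω) := by
  unfold CenterFree
  rw [IntermediateField.fixingSubgroup_top]
  exact Subsingleton.elim _ _

end KappaSol

/-! ## F-1314 `NearlyAbsolutelyPrimitive` ([IUTchI] Rmk 3.2.2 / [FrdII] Ex. 1.1 (ii)) -/

/-- **Row F-1314 is a schema, not a fact**: over a single object with fibre monoid
`Multiplicative ℕ`, the full monoid `Φ = ⊤` is NOT nearly absolutely primitive relative to `R = ⊥`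
(no positive power of the generator is trivial). [cite: Mochizuki2012, IUTchI Rmk 3.2.2 p.76] -/
theorem not_forall_nearlyAbsolutelyPrimitive :
    ¬ ∀ (Obj : Type) (ι : Obj → Type) [∀ A, Monoid (ι A)] (Φ R : ∀ A, Submonoid (ι A)),
      NearlyAbsolutelyPrimitive Φ R := by
  intro h
  obtain ⟨N, hN, hNR⟩ := h Unit (fun _ => Multiplicative ℕ) (fun _ => ⊤) (fun _ => ⊥)
  have h1 := hNR () (Multiplicative.ofAdd 1) trivial
  rw [Submonoid.mem_bot] at h1
  have h2 := congrArg Multiplicative.toAdd h1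
  simp only [toAdd_pow, toAdd_ofAdd, smul_eq_mul, mul_one, toAdd_one] at h2
  omega

/-- … and the predicate is inhabited: every divisor monoid is nearly absolutely primitive relative to
itself (`N = 1`). [cite: Mochizuki2012, IUTchI Rmk 3.2.2 p.76] -/
theorem nearlyAbsolutelyPrimitive_self {Obj : Type*} {ι : Obj → Type*} [∀ A, Monoid (ι A)]
    (Φ : ∀ A, Submonoid (ι A)) : NearlyAbsolutelyPrimitive Φ Φ :=
  ⟨1, Nat.one_pos, fun _ x hx => by rwa [pow_one]⟩

/-! ## F-0751 `InjectiveAlongLinear` ([IUTchI] Rmk 3.2.3 (ii) / [FrdI] Prop. 1.11 (iv)) -/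

/-- **Row F-0751 is a schema, not a fact**: birational-units DATA whose pull-back maps are all trivial
(on the nontrivial group `Multiplicative ℤ`, over the one-object category, every morphism declared
linear) is not injective along linear morphisms. [cite: Mochizuki2012, IUTchI Rmk 3.2.3 (ii) p.77] -/
theorem not_forall_injectiveAlongLinear :
    ¬ ∀ (F : Type) [CategoryTheory.Category.{0} F] (U : S3RemarksLocal.BiratUnits.{0, 0, 0} F),
      InjectiveAlongLinear U := by
  intro h
  let U : S3RemarksLocal.BiratUnits.{0, 0, 0} (CategoryTheory.Discrete Unit) :=
    { IsLinear := fun _ => True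
      units := fun _ => Multiplicative ℤ
      pull := fun _ => 1 }
  have hinj : Function.Injective (U.pull (CategoryTheory.CategoryStruct.id (⟨()⟩ : CategoryTheory.Discrete Unit))) :=
    h _ U _ trivial
  have h01 : (U.pull (CategoryTheory.CategoryStruct.id (⟨()⟩ : CategoryTheory.Discrete Unit)))
        (Multiplicative.ofAdd (0 : ℤ) : Multiplicative ℤ) =
      (U.pull (CategoryTheory.CategoryStruct.id (⟨()⟩ : CategoryTheory.Discrete Unit)))
        (Multiplicative.ofAdd (1 : ℤ) : Multiplicative ℤ) := rfl
  have h2 : (Multiplicative.ofAdd (0 : ℤ) : Multiplicative ℤ) = Multiplicative.ofAdd (1 : ℤ) := hinj h01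
  have h3 := congrArg Multiplicative.toAdd h2
  simp only [toAdd_ofAdd] at h3
  exact absurd h3 (by norm_num)

/-- … and the predicate is inhabited: birational-units data whose pull-back maps are identities (one
object, any group, every morphism linear) is injective along linear morphisms.
[cite: Mochizuki2012, IUTchI Rmk 3.2.3 (ii) p.77] -/
theorem injectiveAlongLinear_id (G : Type) [CommGroup G] :
    InjectiveAlongLinear
      ({ IsLinear := fun _ => True, units := fun _ => G, pull := fun _ => MonoidHom.id G } :
        S3RemarksLocal.BiratUnits.{0, 0, 0} (CategoryTheory.Discrete Unit)) :=
  fun _ _ => Function.injective_id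

end Literature.IUT.HodgeTheaters
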